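import Summits.QuantumFields.YangMills.Theorems.TwistedTraceScaling.Negative.CoreDefectRecordRate
import Summits.QuantumFields.YangMills.Theorems.TwistedTraceScaling.Negative.FlatProximityQuartic
import Summits.QuantumFields.YangMills.Theorems.LuscherReductionTwistedTraceScalingBOAssemblyBricks
import HarnessLib

/-!
# R55 (crux `TwistedTraceScaling`, stmt-QuantumFields-20203): `BOBricks.hcore` puts an ACTION FLOOR under the slow window — the core `{orbitDist < 13(L³β)^{-1/5}}`
# contains one-site configurations with `L³·S(u) ≥ L³·(13(L³β)^{-1/5})⁴/64` and one-site magnetic exponent `(L³β/2)·S(u) ≥ (13⁴/128)(L³β)^{1/5} → ∞`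

Standing disprover `ym-cdisprove-20203-1` (gen 44); sequel of R54–R54D (`…Negative.CoreWindowLedger` … `…Negative.CoreDefectRecordRate`: the (C4) WINDOW LEDGER —
`BOBricks.hcore` forces the INPUT RADIUS of every support window, exponent `p ≤ 1/5`).  This file prices the OTHER clause of the support windows used on lane A
(`ym-luscher-20007-p1`): the ACTION CEILING `L³·wilsonAction su2Rep u ≤ σ(β)` (record `…BOCoreDefectRecord`: `σ = powScale (1/3) β`; `…BOCentralRecordTwo`: `powScale (1/2) β`;
R54B `repairedWindows_exponent_hb_small`: any `σ ≤ S·powScale q β` with `q > 1/3` passes `hb_small`).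

WITNESS (§1–§3, no new definitions) = the one-site CROSS configuration `(a_φ, b_φ, 1)` — the tree's `PhysL2.twoLinkCfg (L := 1) a b` with `a`, `b` any elements whose quaternions are
`(cos φ, sin φ, 0, 0)`, `(cos φ, 0, sin φ, 0)` (R8 `exists_su2Quat_eq`): `orbitDist ≤ 2√2·|φ|` (compare with the vacuum) and `S ≥ 4 sin⁴φ` (the `(0,1)` plaquette is the commutator:
`2(1 − u₀(aba⁻¹b⁻¹)) = 4|u_a × u_b|² = 4 sin⁴φ`, `PhysL2.scalarPart_comm_eq`).  With `φ = R/3`, `0 < R ≤ 3`: `orbitDist < R` and `S ≥ R⁴/64` (`sin t ≥ 3t/4` on `[0,1]`).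

RESULTS (all [folklore]; `L ≥ 1` is the block size of `BOBricks`, `β → ∞`, `B = L³β` the one-site coupling):
* §3 `core_witness`: every radius `0 < R ≤ 3` has a one-site `u` with `orbitDist u < R` and `R⁴/64 ≤ S(u)`.
* §4 ★★ `action_floor_of_hcore` (and `BOBricks.action_floor`): `hcore` (`orbitDist u < 13(L³β)^{-1/5} → u ∈ 𝒰 β`) together with an action ceiling on the window
  (`u ∈ 𝒰 β → L³·S(u) ≤ σ β`) forces `L³·(13(L³β)^{-1/5})⁴/64 ≤ σ β` eventually.  ★ `core_magnetic_exponent_ge` / `core_magnetic_exponent_unbounded`: eventually the core contains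
  `u` with `(13⁴/128)(L³β)^{1/5} ≤ (L³β/2)·S(u)`, hence `≥ M` for any `M` — the slow window of `BOBricks` is NOT inside any region of bounded one-site magnetic exponent
  (in Lüscher's coordinates `x = u/λ_b(B)` it reaches `|x| ≍ B^{2/15} → ∞`, where `λ_b·V(x) ≍ B^{1/5}`).
* §5 ★★ THE ACTION-EXPONENT BAND: `action_exponent_le_of_hcore`: a ceiling `σ ≤ S·powScale q β` on a window containing the core has `q ≤ 4/5`; with R54B (`q > 1/3` is what
  `hb_small` needs) the admissible band is `1/3 < q ≤ 4/5`.  `floor_le_of_exponent_lt`: every `q < 4/5` (any constant `S > 0`) clears the floor eventually — lane A's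
  `powScale (1/2) β` (`…BOCentralRecordTwo`) and the record's `powScale (1/3) β` sit inside the band (the record window fails `hcore` through its QUATERNION clause, R54D);
  the perturbative core `q = 1` (`L³S ≤ β^{-1}`) and every `q > 4/5` contradict `hcore`.
CONSEQUENCE (information for the lead / lane A, no kill): the bricks quantified over ALL amplitudes `φ` supported in `𝒰 β` (`hN`, `hT`, `hOD`) must hold uniformly out to one-site
configurations of magnetic Boltzmann weight `exp(−(13⁴/128)(L³β)^{1/5})`; no estimate assuming `(L³β)·S(u) = O(1)` on the slow window is available under `hcore`.
HONEST FRAMING: stub of a child of the CONDITIONAL reduction route R2b1 (skeleton «twolattice», S-BASE lane); nothing here refutes `TwistedTraceScaling`, S-BASE or any landed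
theorem; (C4), (C5), (B-ST) remain OPEN; not infinite volume, not a mass gap, not Clay.
-/

set_option autoImplicit false

noncomputable section

open Real Filter Topology
open scoped Matrix Quaternion BigOperators
open Literature.MathematicalPhysics.QuantumFieldTheory hiding SU2
open Literature.MathematicalPhysics.QuantumLattice
open Summit.QuantumFields.YangMills.Theorems.FemtoTransferGap
open Summit.QuantumFields.YangMills.Theorems.FemtoTransferGap.TwoLattice
open Summit.QuantumFields.YangMills.Theorems.FemtoTransferGap.PhysL2 (twoLinkCfg plaquetteHolonomy_twoLinkCfg scalarPart_comm_eq)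
open Summit.QuantumFields.YangMills.Theorems.FemtoTransferGap.TwoLattice.Cov (hol wilsonAction_eq_sum_scalarPart)
open Summit.QuantumFields.YangMills.Theorems.FemtoTransferGap.TwoLattice.ConstTube (BOBricks powScale_mul_powScale tendsto_powScale')
open Summit.QuantumFields.YangMills.Theorems.TwistedTraceScaling.Negative

namespace Summit.QuantumFields.YangMills.Theorems.TwistedTraceScaling.Negative.R55

/-! ## §1 The one-site cross configuration `(a_φ, b_φ, 1)` and its orbit distance

No new definitions: the witness is the tree's `PhysL2.twoLinkCfg (L := 1) a b` with `a`, `b` ANY elements of `SU(2)` whose quaternions are `(cos φ, sin φ, 0, 0)` and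
`(cos φ, 0, sin φ, 0)` (they exist: R8 `exists_su2Quat_eq`); all lemmas are parametric in `a`, `b`. -/

/-- Reading `u₀` off an explicit quaternion. [folklore] -/
theorem scalarPart_of_su2Quat_eq {U : FemtoTransferGap.SU2} {r i j k : ℝ} (h : su2Quat U = ⟨r, i, j, k⟩) : scalarPart U = r := by
  unfold scalarPart; rw [h]

/-- The three links of the cross configuration `twoLinkCfg a b` on the one-site lattice: `(a, b, 1)`. [folklore] -/
theorem twoLinkCfg_apply (a b : FemtoTransferGap.SU2) (x : Site 3 1) :
    twoLinkCfg (L := 1) a b (x, 0) = a ∧ twoLinkCfg (L := 1) a b (x, 1) = b ∧ twoLinkCfg (L := 1) a b (x, 2) = 1 := by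
  refine ⟨?_, ?_, ?_⟩ <;> simp [twoLinkCfg]

/-- `‖U − 1‖_F ≤ √2·|φ|` when `u₀(U) = cos φ` (`‖U − 1‖_F² = 4(1 − u₀)`, `1 − cos φ ≤ φ²/2`). [folklore] -/
theorem frobNorm_sub_one_le_of_scalarPart {U : FemtoTransferGap.SU2} {φ : ℝ} (h : scalarPart U = Real.cos φ) :
    frobNorm ((U : Matrix (Fin 2) (Fin 2) ℂ) - 1) ≤ Real.sqrt 2 * |φ| := by
  have hsq : frobNorm ((U : Matrix (Fin 2) (Fin 2) ℂ) - 1) ^ 2 ≤ (Real.sqrt 2 * |φ|) ^ 2 := by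
    rw [frobNorm_sub_one_sq_eq_scalarPart, h, mul_pow, Real.sq_sqrt (by norm_num), sq_abs]
    have hc := Real.one_sub_sq_div_two_le_cos (x := φ)
    linarith
  exact (pow_le_pow_iff_left₀ (frobNorm_nonneg _) (by positivity) two_ne_zero).mp hsq

/-- **`orbitDist (a, b, 1) ≤ 2√2·|φ|`** when `u₀(a) = u₀(b) = cos φ` (compare with the vacuum: two links at Frobenius distance `≤ √2|φ|` from `1`, the third equal to `1`).
[folklore] -/
theorem orbitDist_twoLinkCfg_le {a b : FemtoTransferGap.SU2} {φ : ℝ} (ha : scalarPart a = Real.cos φ) (hb : scalarPart b = Real.cos φ) :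
    orbitDist (twoLinkCfg (L := 1) a b) ≤ 2 * Real.sqrt 2 * |φ| := by
  refine (orbitDist_le 1 (twoLinkCfg (L := 1) a b)).trans ?_
  unfold gaugeDist
  have h1 : ∀ e : Edge 3 1, gaugeTransform (1 : Site 3 1 → FemtoTransferGap.SU2) (twoLinkCfg (L := 1) a b) e = twoLinkCfg (L := 1) a b e := fun e => by
    simp [gaugeTransform]
  simp_rw [h1]
  rw [Fintype.sum_prod_type, Fintype.sum_unique, Fin.sum_univ_three]
  obtain ⟨e0, e1, e2⟩ := twoLinkCfg_apply a b default
  rw [e0, e1, e2, OneMemClass.coe_one, sub_self, frobNorm_zero, add_zero]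
  have ha' := frobNorm_sub_one_le_of_scalarPart ha
  have hb' := frobNorm_sub_one_le_of_scalarPart hb
  linarith

/-! ## §2 The action of the cross configuration: the `(0,1)` plaquette is the commutator -/

/-- The `(0,1)` plaquette term of `twoLinkCfg a_φ b_φ` is EXACTLY `4 sin⁴φ` on any lattice (`u₀(aba⁻¹b⁻¹) = 1 − 2|u_a × u_b|²`, `u_a = (sin φ,0,0)`, `u_b = (0,sin φ,0)`;
R8 `plaqTerm_twoLinkCfg_le` is the inequality). [cite: Luscher1983, §2] -/
theorem plaqTerm_twoLinkCfg_eq {M : ℕ} {a b : FemtoTransferGap.SU2} {φ : ℝ} (ha : su2Quat a = ⟨Real.cos φ, Real.sin φ, 0, 0⟩)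
    (hb : su2Quat b = ⟨Real.cos φ, 0, Real.sin φ, 0⟩) (x : Site 3 M) :
    2 * (1 - scalarPart (plaquetteHolonomy (twoLinkCfg (L := M) a b) x 0 1)) = 4 * Real.sin φ ^ 4 := by
  obtain ⟨-, ha0, ha1, ha2⟩ := R8.entries_of_su2Quat_eq ha
  obtain ⟨-, hb0, hb1, hb2⟩ := R8.entries_of_su2Quat_eq hb
  rw [plaquetteHolonomy_twoLinkCfg, scalarPart_comm_eq, cross_apply]
  simp only [vecPart_zero, vecPart_one, vecPart_two, ha0, ha1, ha2, hb0, hb1, hb2]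
  simp [dotProduct, Fin.sum_univ_three]
  ring

/-- Every plaquette term `2(1 − u₀(hol))` is nonnegative. [folklore] -/
theorem plaqTerm_nonneg {M : ℕ} (U : GaugeConfig 3 M FemtoTransferGap.SU2) (p : Plaquette 3 M) : 0 ≤ 2 * (1 - scalarPart (hol U p)) := by
  have := (le_abs_self _).trans (abs_scalarPart_le (hol U p)); linarith

/-- **`4 sin⁴φ ≤ S(a_φ, b_φ, 1)`** on the one-site lattice (every plaquette term is nonnegative; keep the `(0,1)` one). [cite: Luscher1983, §2] -/
theorem four_mul_sin_pow_le_wilsonAction_twoLinkCfg {a b : FemtoTransferGap.SU2} {φ : ℝ} (ha : su2Quat a = ⟨Real.cos φ, Real.sin φ, 0, 0⟩)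
    (hb : su2Quat b = ⟨Real.cos φ, 0, Real.sin φ, 0⟩) : 4 * Real.sin φ ^ 4 ≤ wilsonAction su2Rep (twoLinkCfg (L := 1) a b) := by
  rw [wilsonAction_eq_sum_scalarPart]
  calc 4 * Real.sin φ ^ 4
      = 2 * (1 - scalarPart (hol (twoLinkCfg (L := 1) a b) (((0 : Site 3 1), ⟨((0 : Fin 3), (1 : Fin 3)), by decide⟩) : Plaquette 3 1))) :=
        (plaqTerm_twoLinkCfg_eq ha hb 0).symm
    _ ≤ ∑ p : Plaquette 3 1, 2 * (1 - scalarPart (hol (twoLinkCfg (L := 1) a b) p)) :=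
        Finset.single_le_sum (f := fun p : Plaquette 3 1 => 2 * (1 - scalarPart (hol (twoLinkCfg (L := 1) a b) p))) (fun p _ => plaqTerm_nonneg _ p)
          (Finset.mem_univ (((0 : Site 3 1), ⟨((0 : Fin 3), (1 : Fin 3)), by decide⟩) : Plaquette 3 1))

/-! ## §3 The core witness -/

/-- `3t/4 ≤ sin t` on `[0,1]` (`sin t > t − t³/6` for `t > 0`). [folklore] -/
theorem three_quarters_mul_le_sin {t : ℝ} (h0 : 0 ≤ t) (h1 : t ≤ 1) : 3 / 4 * t ≤ Real.sin t := by
  rcases h0.eq_or_lt with h | hpos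
  · rw [← h]; simp
  · have h := Real.sin_gt_sub_cube hpos
    have h2 : t ^ 2 ≤ 1 := by nlinarith
    have h3 : t ^ 3 ≤ t := by nlinarith [mul_le_mul_of_nonneg_left h2 h0]
    nlinarith

/-- ★ **CORE WITNESS**: for `0 < R ≤ 3` the one-site configuration `(a_{R/3}, b_{R/3}, 1)` has `orbitDist < R` and `S ≥ R⁴/64`. [folklore] -/
theorem core_witness {R : ℝ} (hR0 : 0 < R) (hR3 : R ≤ 3) {a b : FemtoTransferGap.SU2} (ha : su2Quat a = ⟨Real.cos (R / 3), Real.sin (R / 3), 0, 0⟩)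
    (hb : su2Quat b = ⟨Real.cos (R / 3), 0, Real.sin (R / 3), 0⟩) :
    orbitDist (twoLinkCfg (L := 1) a b) < R ∧ R ^ 4 / 64 ≤ wilsonAction su2Rep (twoLinkCfg (L := 1) a b) := by
  have hs2 : Real.sqrt 2 < 3 / 2 := by
    rw [show (3 / 2 : ℝ) = Real.sqrt ((3 / 2) ^ 2) from (Real.sqrt_sq (by norm_num)).symm]
    exact Real.sqrt_lt_sqrt (by norm_num) (by norm_num)
  refine ⟨lt_of_le_of_lt (orbitDist_twoLinkCfg_le (scalarPart_of_su2Quat_eq ha) (scalarPart_of_su2Quat_eq hb)) ?_, ?_⟩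
  · rw [abs_of_pos (by positivity)]
    nlinarith [mul_lt_mul_of_pos_left hs2 hR0]
  · have hsin : 3 / 4 * (R / 3) ≤ Real.sin (R / 3) := three_quarters_mul_le_sin (by positivity) (by linarith)
    have h4 : (3 / 4 * (R / 3)) ^ 4 ≤ Real.sin (R / 3) ^ 4 := pow_le_pow_left₀ (by positivity) hsin 4
    have hS := four_mul_sin_pow_le_wilsonAction_twoLinkCfg ha hb
    have : R ^ 4 / 64 = 4 * (3 / 4 * (R / 3)) ^ 4 := by ring
    rw [this]; linarith

/-- ★ For every `0 < R ≤ 3` SOME one-site configuration has `orbitDist < R` and `S ≥ R⁴/64`. [folklore] -/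
theorem exists_core_config {R : ℝ} (hR0 : 0 < R) (hR3 : R ≤ 3) :
    ∃ u : GaugeConfig 3 1 FemtoTransferGap.SU2, orbitDist u < R ∧ R ^ 4 / 64 ≤ wilsonAction su2Rep u := by
  obtain ⟨a, ha⟩ := R8.exists_su2Quat_eq _ (R8.normSq_axisI (R / 3))
  obtain ⟨b, hb⟩ := R8.exists_su2Quat_eq _ (R8.normSq_axisJ (R / 3))
  exact ⟨_, core_witness hR0 hR3 ha hb⟩

variable {L : ℕ} [NeZero L]

/-! ## §4 ★★ The action floor forced by `hcore`, and the magnetic exponent on the core -/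

/-- ★★ **`hcore` PUTS A FLOOR UNDER ANY ACTION CEILING OF THE SLOW WINDOW**: if `𝒰_β ⊇ {orbitDist < 13(L³β)^{-1/5}}` (`BOBricks.hcore`) and `L³·S(u) ≤ σ(β)` on `𝒰_β`,
then `L³·(13(L³β)^{-1/5})⁴/64 ≤ σ(β)` eventually. [folklore] -/
theorem action_floor_of_hcore {𝒰 : ℝ → Set (GaugeConfig 3 1 FemtoTransferGap.SU2)} {σ : ℝ → ℝ}
    (hcore : ∀ᶠ β : ℝ in atTop, ∀ u : GaugeConfig 3 1 FemtoTransferGap.SU2, orbitDist u < 13 * (((L : ℝ)) ^ 3 * β) ^ (-(1 / 5 : ℝ)) → u ∈ 𝒰 β)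
    (hceil : ∀ᶠ β : ℝ in atTop, ∀ u ∈ 𝒰 β, (L : ℝ) ^ 3 * wilsonAction su2Rep u ≤ σ β) :
    ∀ᶠ β : ℝ in atTop, (L : ℝ) ^ 3 * ((13 * (((L : ℝ)) ^ 3 * β) ^ (-(1 / 5 : ℝ))) ^ 4 / 64) ≤ σ β := by
  have h3 : ∀ᶠ β : ℝ in atTop, 13 * (((L : ℝ)) ^ 3 * β) ^ (-(1 / 5 : ℝ)) < 3 :=
    (R54.tendsto_coreRadius (L := L)).eventually (eventually_lt_nhds (by norm_num))
  filter_upwards [hcore, hceil, h3, eventually_gt_atTop (0 : ℝ)] with β hc hσ hR3 hβ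
  obtain ⟨u, hod, hS⟩ := exists_core_config (R54.coreRadius_pos (L := L) hβ) hR3.le
  exact (mul_le_mul_of_nonneg_left hS (by positivity)).trans (hσ _ (hc _ hod))

/-- The same floor, read off lane A's brick list by name: any action ceiling carried by `BOBricks.𝒰` sits above `L³·(13(L³β)^{-1/5})⁴/64`. [folklore] -/
theorem BOBricks.action_floor {χ : ℝ → GaugeConfig 3 L FemtoTransferGap.SU2 → ℝ} {δ : ℝ → ℝ} (B : BOBricks L χ δ) {σ : ℝ → ℝ}
    (hceil : ∀ᶠ β : ℝ in atTop, ∀ u ∈ B.𝒰 β, (L : ℝ) ^ 3 * wilsonAction su2Rep u ≤ σ β) :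
    ∀ᶠ β : ℝ in atTop, (L : ℝ) ^ 3 * ((13 * (((L : ℝ)) ^ 3 * β) ^ (-(1 / 5 : ℝ))) ^ 4 / 64) ≤ σ β :=
  action_floor_of_hcore B.hcore hceil

/-- `(13·x^{-1/5})⁴ = 13⁴·x^{-4/5}` and `x·x^{-4/5} = x^{1/5}` packaged: `(x/2)·((13x^{-1/5})⁴/64) = (13⁴/128)·x^{1/5}` for `x > 0`. [folklore] -/
theorem magnetic_exponent_identity {x : ℝ} (hx : 0 < x) :
    x / 2 * ((13 * x ^ (-(1 / 5 : ℝ))) ^ 4 / 64) = 13 ^ 4 / 128 * x ^ (1 / 5 : ℝ) := by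
  have hR4 : (x ^ (-(1 / 5 : ℝ))) ^ 4 = x ^ (-(4 / 5 : ℝ)) := by
    rw [← Real.rpow_natCast (x ^ (-(1 / 5 : ℝ))) 4, ← Real.rpow_mul hx.le]; norm_num
  have h15 : x * x ^ (-(4 / 5 : ℝ)) = x ^ (1 / 5 : ℝ) := by
    rw [show (1 / 5 : ℝ) = 1 + -(4 / 5) by norm_num, Real.rpow_add hx, Real.rpow_one]
  rw [mul_pow, hR4, ← h15]; ring

/-- ★ **THE CORE CARRIES MAGNETIC EXPONENT `≥ (13⁴/128)(L³β)^{1/5}`**: eventually in `β` the `hcore` core contains a one-site `u` with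
`(13⁴/128)(L³β)^{1/5} ≤ (L³β/2)·S(u)` (the exponent of the one-site magnetic Boltzmann weight `exp(−(B/2)S)` at `B = L³β`). [folklore] -/
theorem core_magnetic_exponent_ge :
    ∀ᶠ β : ℝ in atTop, ∃ u : GaugeConfig 3 1 FemtoTransferGap.SU2, orbitDist u < 13 * (((L : ℝ)) ^ 3 * β) ^ (-(1 / 5 : ℝ)) ∧
      13 ^ 4 / 128 * (((L : ℝ)) ^ 3 * β) ^ (1 / 5 : ℝ) ≤ (L : ℝ) ^ 3 * β / 2 * wilsonAction su2Rep u := by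
  have hL : (0 : ℝ) < (L : ℝ) ^ 3 := pow_pos (by exact_mod_cast Nat.pos_of_ne_zero (NeZero.ne L)) 3
  have h3 : ∀ᶠ β : ℝ in atTop, 13 * (((L : ℝ)) ^ 3 * β) ^ (-(1 / 5 : ℝ)) < 3 :=
    (R54.tendsto_coreRadius (L := L)).eventually (eventually_lt_nhds (by norm_num))
  filter_upwards [h3, eventually_gt_atTop (0 : ℝ)] with β hR3 hβ
  obtain ⟨u, hod, hS⟩ := exists_core_config (R54.coreRadius_pos (L := L) hβ) hR3.le
  refine ⟨u, hod, ?_⟩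
  rw [← magnetic_exponent_identity (mul_pos hL hβ)]
  exact mul_le_mul_of_nonneg_left hS (by positivity)

/-- ★ **… HENCE UNBOUNDED**: for every `M`, eventually the `hcore` core contains a one-site `u` with `M ≤ (L³β/2)·S(u)` — the slow window of `BOBricks` is inside no region of
bounded one-site magnetic exponent. [folklore] -/
theorem core_magnetic_exponent_unbounded (M : ℝ) :
    ∀ᶠ β : ℝ in atTop, ∃ u : GaugeConfig 3 1 FemtoTransferGap.SU2, orbitDist u < 13 * (((L : ℝ)) ^ 3 * β) ^ (-(1 / 5 : ℝ)) ∧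
      M ≤ (L : ℝ) ^ 3 * β / 2 * wilsonAction su2Rep u := by
  have hL : (0 : ℝ) < (L : ℝ) ^ 3 := pow_pos (by exact_mod_cast Nat.pos_of_ne_zero (NeZero.ne L)) 3
  have ht : Tendsto (fun β : ℝ => 13 ^ 4 / 128 * (((L : ℝ)) ^ 3 * β) ^ (1 / 5 : ℝ)) atTop atTop :=
    ((tendsto_rpow_atTop (by norm_num : (0 : ℝ) < 1 / 5)).comp (tendsto_id.const_mul_atTop hL)).const_mul_atTop (by positivity)
  filter_upwards [core_magnetic_exponent_ge (L := L), ht.eventually_ge_atTop M] with β ⟨u, hu, hge⟩ hM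
  exact ⟨u, hu, hM.trans hge⟩

/-! ## §5 ★★ The action-exponent band `1/3 < q ≤ 4/5` -/

omit [NeZero L] in
/-- `(13·(L³β)^{-1/5})⁴ = (13·(L³)^{-1/5})⁴ · powScale (4/5) β` for `β ≥ 1`. [folklore] -/
theorem coreRadius_pow_four {β : ℝ} (hβ : 1 ≤ β) :
    (13 * (((L : ℝ)) ^ 3 * β) ^ (-(1 / 5 : ℝ))) ^ 4 = (13 * ((L : ℝ) ^ 3) ^ (-(1 / 5 : ℝ))) ^ 4 * powScale (4 / 5) β := by
  rw [R54.coreRadius_eq hβ, mul_pow]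
  congr 1
  rw [show powScale (1 / 5) β ^ 4 = (powScale (1 / 5) β ^ 2) ^ 2 by ring, R21.powScale_sq, R21.powScale_sq]; norm_num

/-- The floor constant `C_L = L³·(13·(L³)^{-1/5})⁴/64 > 0`. [folklore] -/
theorem floorConst_pos : 0 < (L : ℝ) ^ 3 * ((13 * ((L : ℝ) ^ 3) ^ (-(1 / 5 : ℝ))) ^ 4 / 64) := by
  have hL : (0 : ℝ) < (L : ℝ) ^ 3 := pow_pos (by exact_mod_cast Nat.pos_of_ne_zero (NeZero.ne L)) 3
  have := Real.rpow_pos_of_pos hL (-(1 / 5 : ℝ))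
  positivity

/-- ★★ **`hcore` CAPS THE ACTION EXPONENT AT `4/5`**: if the slow window contains the core (`hcore`) and carries an action ceiling `L³S ≤ σ ≤ S·powScale q β`, then `q ≤ 4/5`
(R54B needs `q > 1/3` for `hb_small`; the admissible band is `1/3 < q ≤ 4/5`). [folklore] -/
theorem action_exponent_le_of_hcore {𝒰 : ℝ → Set (GaugeConfig 3 1 FemtoTransferGap.SU2)} {σ : ℝ → ℝ} {q S : ℝ}
    (hcore : ∀ᶠ β : ℝ in atTop, ∀ u : GaugeConfig 3 1 FemtoTransferGap.SU2, orbitDist u < 13 * (((L : ℝ)) ^ 3 * β) ^ (-(1 / 5 : ℝ)) → u ∈ 𝒰 β)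
    (hceil : ∀ᶠ β : ℝ in atTop, ∀ u ∈ 𝒰 β, (L : ℝ) ^ 3 * wilsonAction su2Rep u ≤ σ β)
    (hσ : ∀ᶠ β : ℝ in atTop, σ β ≤ S * powScale q β) : q ≤ 4 / 5 := by
  by_contra hq
  rw [not_le] at hq
  set C : ℝ := (L : ℝ) ^ 3 * ((13 * ((L : ℝ) ^ 3) ^ (-(1 / 5 : ℝ))) ^ 4 / 64) with hC
  have hC0 : 0 < C := floorConst_pos (L := L)
  have hsmall : ∀ᶠ β : ℝ in atTop, (|S| + 1) * powScale (q - 4 / 5) β < C := by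
    have ht := (tendsto_powScale' (sub_pos.mpr hq)).const_mul (|S| + 1)
    rw [mul_zero] at ht
    exact ht.eventually (eventually_lt_nhds hC0)
  obtain ⟨β, hfl, hs, hsm, hβ1⟩ := ((action_floor_of_hcore hcore hceil).and (hσ.and (hsmall.and (eventually_ge_atTop (1 : ℝ))))).exists
  rw [coreRadius_pow_four hβ1] at hfl
  have hp0 : 0 < powScale (4 / 5) β := powScale_pos _ _
  have hpq0 : 0 ≤ powScale (q - 4 / 5) β := (powScale_pos _ _).le
  have hq' : powScale q β = powScale (4 / 5) β * powScale (q - 4 / 5) β := by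
    rw [powScale_mul_powScale]; congr 1; ring
  have h1 : C * powScale (4 / 5) β ≤ S * powScale q β := by
    have : C * powScale (4 / 5) β = (L : ℝ) ^ 3 * ((13 * ((L : ℝ) ^ 3) ^ (-(1 / 5 : ℝ))) ^ 4 * powScale (4 / 5) β / 64) := by rw [hC]; ring
    rw [this]; exact hfl.trans hs
  have h2 : S * powScale q β ≤ (|S| + 1) * powScale (q - 4 / 5) β * powScale (4 / 5) β := by
    rw [hq']
    nlinarith [le_abs_self S, mul_nonneg hpq0 hp0.le]
  have h3 : (|S| + 1) * powScale (q - 4 / 5) β * powScale (4 / 5) β < C * powScale (4 / 5) β := mul_lt_mul_of_pos_right hsm hp0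
  linarith

omit [NeZero L] in
/-- ★ **… AND EVERY EXPONENT BELOW `4/5` CLEARS THE FLOOR**: for `q < 4/5` and any constant `S > 0`, `L³·(13(L³β)^{-1/5})⁴/64 ≤ S·powScale q β` eventually — so the action
clauses `powScale (1/2) β` (`…BOCentralRecordTwo`) and `powScale (1/3) β` (the record) are consistent with `hcore`; together with R54B the action-ceiling band is `1/3 < q ≤ 4/5`
(`q = 4/5` itself needs `S ≥ C_L`). [folklore] -/
theorem floor_le_of_exponent_lt {q S : ℝ} (hq : q < 4 / 5) (hS : 0 < S) :
    ∀ᶠ β : ℝ in atTop, (L : ℝ) ^ 3 * ((13 * (((L : ℝ)) ^ 3 * β) ^ (-(1 / 5 : ℝ))) ^ 4 / 64) ≤ S * powScale q β := by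
  set C : ℝ := (L : ℝ) ^ 3 * ((13 * ((L : ℝ) ^ 3) ^ (-(1 / 5 : ℝ))) ^ 4 / 64) with hC
  have hsmall : ∀ᶠ β : ℝ in atTop, C * powScale (4 / 5 - q) β ≤ S := by
    have ht := (tendsto_powScale' (sub_pos.mpr hq)).const_mul C
    rw [mul_zero] at ht
    exact ht.eventually (eventually_le_nhds hS)
  filter_upwards [hsmall, eventually_ge_atTop (1 : ℝ)] with β hsm hβ1
  rw [coreRadius_pow_four hβ1]
  have h45 : powScale (4 / 5) β = powScale q β * powScale (4 / 5 - q) β := by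
    rw [powScale_mul_powScale]; congr 1; ring
  calc (L : ℝ) ^ 3 * ((13 * ((L : ℝ) ^ 3) ^ (-(1 / 5 : ℝ))) ^ 4 * powScale (4 / 5) β / 64) = C * powScale (4 / 5) β := by rw [hC]; ring
    _ = C * powScale (4 / 5 - q) β * powScale q β := by rw [h45]; ring
    _ ≤ S * powScale q β := mul_le_mul_of_nonneg_right hsm (powScale_pos _ _).le

/-- Numbers: the band `1/3 < q ≤ 4/5` contains lane A's `1/2` and the record's `1/3 + ε`, excludes the perturbative core `q = 1`; `13⁴/64 = 28561/64`, `13⁴/128 = 28561/128`;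
`2√2 < 3` as `8 < 9`; `(3/4)⁴·4/3⁴ = 1/64`. -/
example : (1 : ℝ) / 3 < 1 / 2 ∧ (1 : ℝ) / 2 ≤ 4 / 5 ∧ ¬ ((1 : ℝ) ≤ 4 / 5) ∧ (13 : ℝ) ^ 4 / 64 = 28561 / 64 ∧ (13 : ℝ) ^ 4 / 128 = 28561 / 128 ∧
    (8 : ℝ) < 9 ∧ ((3 : ℝ) / 4) ^ 4 * 4 / 3 ^ 4 = 1 / 64 := by norm_num

end Summit.QuantumFields.YangMills.Theorems.TwistedTraceScaling.Negative.R55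

end
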